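import Summits.QuantumFields.BalabanUV.T4Continuum.Support.ShellMeasureLiveEndLevelBlind
import Summits.QuantumFields.BalabanUV.T4Continuum.Support.ShellMeasureLiveEndOneCallSlotLevelsCf
import Summits.QuantumFields.BalabanUV.T4Continuum.Support.ShellMeasureRootCompositionSync

/-!
# `T4Continuum.ShellMeasureLiveEndOneCallLevelsCf` — row S102 file 2″ «THE ONE CALL v2 — R11 DISCHARGED»: END-I ∘ END-II (S99 f3b) IN ONE
# DECLARATION — `ShellWeightBound` ⇐ THE NAMED BINDERS, the Landau-correction row R11 no longer among them
(cell `pub-balaban`, sub-cell `t4`, NE7c (node U5b); crew unit `b2b-balaban-t4-ne7c-formalise-leaf-09` gen 13; owner table row **S102**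
(R-ne7cp1-g35-4 (c)); imports the owner's `ShellMeasureLiveEndLevelBlind` (for the (x2″) example), file 1″ `ShellMeasureLiveEndOneCallSlotLevelsCf`
and S27 `ShellMeasureRootCompositionSync` ONLY; [folklore]; 0 `def`, 0 `def … : Prop`, 0 sorry, 0 citation tags; statement generated by the
same script as file 1″)

HONEST FRAMING.  Finite four-torus programme, rung (B)+1 only — NOT infinite volume, NOT a mass gap, NOT the Clay problem, NOT
summit progress; (B), `BetaPertHyp`, (B^μ) not consumed.  NE7c (`T4IndicatorShell.ShellWeightBound`) is NOT PRINTED in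
[Balaban 1983–89] and NOT PROVED; «NE7c ⇐ the named binders» (trigger c3): every binder below is DISPLAYED, asserted by nobody;
no estimate of Bałaban's is discharged; (M1) realized ≠ NE7c.  Equation numbers in comments LOCATE displayed shapes, not
citations.  HONEST DEPENDENCY (cell): continuum YM on T⁴ ⇐ BetaPertH ∧ nine spine estimates (0/9 proved); BetaPertH ⇐ (D1) ∧ (D4)
∧ CAP+tail; G-an2-4 gates asym, D1 and NE2/3/4.
THIS declaration (with file 3″'s union form) IS the countdown's object at the live levels; landing it moves NOTHING of Bałaban's —
what moves is OUR hypothesis count (the owner's census (x3″): R11's 18 names ∕ 9 [T] hypotheses + `hCr hCrw hlocC` leave, the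
located regularity `h52locw h52loce` [T] + four α₀-numbers [D] + pins∕reach [R] enter).

WHAT IS PROVED ([folklore]).  **`shellWeightBound_live_oneCall_levels_cfB7`** := END-I S27 `shellWeightBound_of_towerData_sync` (G := SU2; run `r`'s
slot `s` of comparison `K` on `(P r K s, jl r K s)`; thresholds BY AGE `ε r (K − lvl r K s)`) with `hacA`∕`hacB` DISCHARGED by file 1″
`hac_live_of_assembled_decay_levels_cfB7` (S99 f3b ∘ S90) at `r := true ∕ false`.  Binders: file 1″'s `(r, K, t, s)`-families of EVERY S99 f3b
binder VERBATIM; the slot→level majorant `hDslot` (S99 f3b's constant — S80 f6's with `C₂w·RCw ↦ C2cov d·landauRad d L`,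
`C₂e ↦ C2cov d·e^{2δ′r₀e}` — written ONCE, level-lifted letters); END-I's rows VERBATIM ((R)+[dict] per run with the NORMALISED
variables `u ∕ η²` in the shell events, finiteness, `LiveWindow` ×2 (SM-L7), `0 < ϑ < 1`, `D ≤ D̄`, rates (SM-L8, U1b BY NAME)).
CONCLUSION LITERALLY `ShellWeightBound l₀ T A B shA shB (fun K => Σ_{s∈Sl true K} D true (lvl true K s)·ρ true (lvl true K s) +
Σ_{s∈Sl false K} …)`.  Tests: (t1) ✓; (t2) NO `SlotAntiConcentration` hypothesis; (t3) WALL rows × both runs + END-I (g)–(k), 0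
`def … : Prop`; (t4) trio; (x1)∕G-1′: S96 `ShellMeasureLiveEndOneCallLevelsToy` is the two-scale witness of S95 f2′ — its S102
twin is due with S99 f3's own witness (the γ3 box datum of S80 f7); (x2″) below.
ROW S102 (R-ne7cp1-g35-4 (c)): S95 f2′ RE-TYPED over file 1″ `ShellMeasureLiveEndOneCallSlotLevelsCf` — THE ONE CALL with R11
DISCHARGED (S99's kernel junction) and the located background regularity `h52locw h52loce` displayed instead; (x2″) the in-file
`example` below: two levels of DIFFERENT fine scale, NONZERO read-out constants, the (SM) rows hold (as S95 f2′).
-/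

noncomputable section

open Set Metric NormedSpace MeasureTheory Function Finset
open scoped ENNReal

namespace Summit.QuantumFields.BalabanUV.T4Continuum.ShellMeasureLiveEndOneCallLevelsCf

open Literature.MathematicalPhysics.QuantumFieldTheory.Balaban1983to89
open B11Prop6Scheme (Prop4Hyp)
open GaugeField (GaugeInvariant)
open T4ShellMeasure (SlotAntiConcentration)
open T4CubePoincare (cube)
open T4CubeChartGnomonic (SU2)
open T4CubeChartExp (expFibreChart)
open T4TreeGaugeFixing (NoClosedLoop fixTo)
open T4ShellMeasurePlaquette (expTail₂)
open ShellMeasureLevelAssembly (classifier)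
open ShellMeasureMultiGridNorms (WSup)
open ShellMeasurePinnedNorm (pinW)
open ShellMeasureDecayKernelSums (kerOp)
open ShellMeasureLandauHolonomy (solAt landauExp)
open ShellMeasureLandauHolonomyChart (holOf cplx)
open ShellMeasureLandauHolonomySkew (readOutReal)
open ShellMeasureMultiGridNorms.WSup (toPiL)
open T4AxialGaugeSmallField (boxPlaqs boxBonds)
open T4AxialGaugeFixing (combBonds)
open B7Prop2Explicit (C0 c2' unitaryUnits)
open B7Prop1Local (pdevOn loK bondHiK)
open B7Prop5Flat (BondIn)
open ShellMeasureAverageProp4General (O1cov C2cov)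
open ShellMeasureLandauCorrectionB7 (landauCf landauRad)
open ShellMeasureLandauCorrectionReal (skewPi)
open ShellMeasureLandauCfBoxLocal (landauCfBox)
open T4IndicatorShell (ShellWeightBound)
open T4ShellMeasureLevels (LiveWindow)
open ShellMeasureRootCompositionSync (shellWeightBound_of_towerData_sync)
open ShellMeasureLiveEndOneCallSlotLevelsCf (hac_live_of_assembled_decay_levels_cfB7)

open scoped Matrix.Norms.L2Operator

variable {σ : Type*} {n : Type*} [Fintype n] [DecidableEq n] [Nonempty n]

/-- **`ShellWeightBound` ⇐ THE NAMED BINDERS, AT THE LIVE LEVELS, IN ONE DECLARATION** (row S102 file 2″; see the module docstring).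
CONDITIONAL on every displayed binder; nothing PRINTED is asserted; NOT Bałaban's minimiser; NOT NE7c proved — NE7c ⇐ these
binders; R11 discharged (S99), the located background regularity displayed. [folklore] -/
theorem shellWeightBound_live_oneCall_levels_cfB7
    (P : Bool → ℕ → σ → Params) (jl lvl : Bool → ℕ → σ → ℕ) [∀ r K s, DecidableEq (PBond (P r K s) (jl r K s))]
    {ε η ρ β D : Bool → ℕ → ℝ} (hη : ∀ r j, 0 < η r j) (hε : ∀ r a, 0 < ε r a) (hρ0 : ∀ r j, 0 ≤ ρ r j) (hD0 : ∀ r j, 0 ≤ D r j)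
    (Sl : Bool → ℕ → Finset σ) {l₀ : ℝ}
    -- EVERY END-II binder of S99 f3b as an (r, K, t, s)-family — file 1″'s list VERBATIM (its section comments there)
    {𝒴 𝒵 ℬ : Bool → ℕ → σ → Type*} [∀ r K s, NormedAddCommGroup (𝒴 r K s)] [∀ r K s, NormedSpace ℂ (𝒴 r K s)]
    [∀ r K s, CompleteSpace (𝒴 r K s)] [∀ r K s, NormedAddCommGroup (𝒵 r K s)] [∀ r K s, NormedSpace ℂ (𝒵 r K s)]
    [∀ r K s, NormedAddCommGroup (ℬ r K s)] [∀ r K s, NormedSpace ℂ (ℬ r K s)] {𝔸 : Bool → ℕ → σ → Type*}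
    [∀ r K s, CStarAlgebra (𝔸 r K s)] [∀ r K s, Nontrivial (𝔸 r K s)]
    {lo hi : ∀ r K s, Fin (P r K s).d → ℤ} {nb : Bool → ℕ → σ → ℕ} (hn : ∀ r K s, ∀ κ, hi r K s κ ≤ lo r K s κ + nb r K s)
    (hN : ∀ r K s, ∀ κ, hi r K s κ - lo r K s κ < (P r K s).sitesPerDir (jl r K s))
    (Λ : ∀ r K s, Finset (PBond (P r K s) (jl r K s))) (hΛbox : ∀ r K s, ∀ b ∈ Λ r K s, b ∈ boxBonds (lo r K s) (hi r K s))
    (hΛcomb : ∀ r K s, Disjoint (Λ r K s) (combBonds (lo r K s) (hi r K s))) {m₀ : Bool → ℕ → σ → ℕ}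
    (e : ∀ r K s, ↥(Λ r K s) × Fin 3 ≃ Fin (m₀ r K s)) {S : ℝ} (hS : 0 < S) (hSπ : 3 * S ^ 2 < Real.pi ^ 2)
    {F : ∀ r K (t : ℝ) s, GaugeField (P r K s) (jl r K s) SU2 → ℝ≥0∞} (hF : ∀ r K t s, Measurable (F r K t s))
    (hFi : ∀ r K t s, GaugeInvariant (F r K t s)) {u : ∀ r K (t : ℝ) s, GaugeField (P r K s) (jl r K s) SU2 → ℝ}
    (hu : ∀ r K t s, Measurable (u r K t s)) (hui : ∀ r K t s, GaugeInvariant (u r K t s)) {ιc : Bool → ℕ → σ → Type*}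
    {Pu : ∀ r K (t : ℝ) s, Finset (ιc r K s)} (hPu : ∀ r K t s, (Pu r K t s).Nonempty)
    (W : ∀ r K (t : ℝ) s, GaugeField (P r K s) (jl r K s) SU2 → Set (Fin (m₀ r K s) → ℝ))
    (Jco : ∀ r K (t : ℝ) s, GaugeField (P r K s) (jl r K s) SU2 → (Fin (m₀ r K s) → ℝ) → ℝ≥0∞) {δ : ℝ}
    (𝒢 : ∀ r K (t : ℝ) s, GaugeField (P r K s) (jl r K s) SU2 → (𝒵 r K s →L[ℂ] (𝒴 r K s)))
    (W𝒱 : ∀ r K (t : ℝ) s, GaugeField (P r K s) (jl r K s) SU2 → 𝒴 r K s → 𝒵 r K s) {B₀ C₄ a₃ ε₄ : ℝ}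
    (h𝒢 : ∀ r K t s, ∀ V f, ‖𝒢 r K t s V f‖ ≤ B₀ * ‖f‖) (hW : ∀ r K t s, ∀ V, Prop4Hyp (W𝒱 r K t s V) C₄ a₃) (hB₀ : 0 < B₀)
    (hC₄ : 0 ≤ C₄) (hε₄ : 0 ≤ ε₄) {dL C₁ B₃ ε₁ : ℝ} (hdL : 0 ≤ dL) (hC₁ : 0 ≤ C₁) (hε₁ : 0 ≤ ε₁) (hB₃ : dL ≤ B₃)
    (h1 : 2 * B₀ * C₁ * B₃ * ε₁ ≤ ε₄) (h2 : 4 * ε₄ ≤ a₃) (h3 : 16 * B₀ * C₄ * ε₄ ≤ 1)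
    (H₁ : ∀ r K (t : ℝ) s, GaugeField (P r K s) (jl r K s) SU2 → (ℬ r K s →L[ℂ] (𝒴 r K s)))
    (hH₁ : ∀ r K t s, ∀ V B, ‖H₁ r K t s V B‖ ≤ B₀ * ‖B‖)
    (Φ : ∀ r K (t : ℝ) s, GaugeField (P r K s) (jl r K s) SU2 → (Fin (m₀ r K s) → ℂ) → ℬ r K s) {rΦ : ℝ}
    (hΦd : ∀ r K t s, ∀ V, DifferentiableOn ℂ (Φ r K t s V) (ball 0 rΦ)) (hΦ0 : ∀ r K t s, ∀ V, Φ r K t s V 0 = 0)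
    (hΦ : ∀ r K t s, ∀ V, ∀ z ∈ ball (0 : Fin (m₀ r K s) → ℂ) rΦ, ‖Φ r K t s V z‖ < 2 * dL * C₁ * ε₁) (hSr : S < rΦ)
    (k : Bool → ℕ → σ → ℕ) (Sf Sf' Sw Sw' Se Se' : ∀ r K s, Finset (B7Prop1Explicit.Site (P r K s).d × Fin (P r K s).d))
    (Ubg : ∀ r K (t : ℝ) s, GaugeField (P r K s) (jl r K s) SU2 → B7Prop1Explicit.Site (P r K s).d → Fin (P r K s).d → (𝔸 r K
      s)ˣ)
    (hUbg : ∀ r K t s, ∀ V x κ, Ubg r K t s V x κ ∈ unitaryUnits (𝔸 r K s)) {α₀ : ℝ} (hα : 0 < α₀)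
    (hα3 : ∀ r K s, C0 (P r K s).d * α₀ ≤ 1 / 3) (hα4 : ∀ r K s, 4 * α₀ ≤ c2' (P r K s).d (P r K s).L)
    (hα6 : ∀ r K s, 4 * O1cov (P r K s).d * α₀ ≤ 1 / 3)
    (h52locw : ∀ r K t s, ∀ V (c : ↥(Sw' r K s)), pdevOn (loK (P r K s).L (k r K s) c.1.1) (bondHiK (P r K s).L (k r K s) c.1.1
      c.1.2) (Ubg r K t s V) < α₀ * ((((P r K s).L : ℝ) ^ k r K s)⁻¹) ^ 2)
    (h52loce : ∀ r K t s, ∀ V (c : ↥(Se' r K s)), pdevOn (loK (P r K s).L (k r K s) c.1.1) (bondHiK (P r K s).L (k r K s) c.1.1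
      c.1.2) (Ubg r K t s V) < α₀ * ((((P r K s).L : ℝ) ^ k r K s)⁻¹) ^ 2)
    (ϖe₁ : ∀ r K (t : ℝ) s, ↥(Se r K s) → ℝ) (ϖe₂ : ∀ r K (t : ℝ) s, ↥(Se' r K s) → ℝ)
    (hϖe₁ : ∀ r K t s, ∀ b, 0 ≤ ϖe₁ r K t s b) (hϖe₂ : ∀ r K t s, ∀ c, 0 ≤ ϖe₂ r K t s c) {r₀e : ℝ}
    (hreache : ∀ r K t s, ∀ (c : ↥(Se' r K s)) (b : ↥(Se r K s)), BondIn (loK (P r K s).L (k r K s) c.1.1) (bondHiK (P r K s).L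
      (k r K s) c.1.1 c.1.2) b.1.1 b.1.2 → ϖe₂ r K t s c - r₀e ≤ ϖe₁ r K t s b)
    (ιs : ∀ r K (t : ℝ) s, GaugeField (P r K s) (jl r K s) SU2 → (𝒴 r K s →L[ℂ] (↥(Sf r K s) → 𝔸 r K s)))
    (hι : ∀ r K t s, ∀ V Y, ‖ιs r K t s V Y‖ ≤ ‖Y‖)
    (Hop : ∀ r K (t : ℝ) s, GaugeField (P r K s) (jl r K s) SU2 → ((↥(Sf' r K s) → 𝔸 r K s) →L[ℂ] (𝒴 r K s)))
    (hH : ∀ r K t s, ∀ V X, ‖Hop r K t s V X‖ ≤ B₀ * ‖X‖) {ε₃ : ℝ} (h18 : ∀ r K s, 18 * C2cov (P r K s).d * B₀ * ε₃ ≤ 1)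
    (hcoup : ε₄ + B₀ * (2 * dL * C₁ * ε₁) ≤ ε₃) (h3R : ∀ r K s, 3 * ε₃ ≤ landauRad (P r K s).d (P r K s).L)
    (ℓs : ∀ r K (t : ℝ) s, ιc r K s → List (𝒴 r K s →L[ℂ] Matrix n n ℂ)) {κr : Bool → ℕ → ℝ} (hκ : ∀ r K s, 0 ≤ κr r (jl r K s))
    (hℓ : ∀ r K t s, ∀ p ∈ Pu r K t s, ∀ ℓ ∈ ℓs r K t s p, ∀ Y, ‖ℓ Y‖ ≤ κr r (jl r K s) * ‖Y‖) {m : ℕ}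
    (hlen : ∀ r K t s, ∀ p ∈ Pu r K t s, (ℓs r K t s p).length ≤ m) {κc : Bool → ℕ → ℝ} (hκc : ∀ r K s, 0 ≤ κc r (jl r K s))
    (hcurl : ∀ r K t s, ∀ p ∈ Pu r K t s, ∀ Y, ‖((ℓs r K t s p).map fun ℓ => ℓ Y).sum‖ ≤ κc r (jl r K s) * ‖Y‖)
    {Λw Λz Λb 𝔖 : Bool → ℕ → σ → Type*} [∀ r K s, Fintype (Λw r K s)] [∀ r K s, DecidableEq (Λw r K s)]
    [∀ r K s, Fintype (Λz r K s)] [∀ r K s, Fintype (Λb r K s)] {𝔄w ℭ 𝔇 : Bool → ℕ → σ → Type*}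
    [∀ r K s, NormedAddCommGroup (𝔄w r K s)] [∀ r K s, NormedSpace ℂ (𝔄w r K s)] [∀ r K s, CompleteSpace (𝔄w r K s)]
    [∀ r K s, NormedAddCommGroup (ℭ r K s)] [∀ r K s, NormedSpace ℂ (ℭ r K s)] [∀ r K s, NormedAddCommGroup (𝔇 r K s)]
    [∀ r K s, NormedSpace ℂ (𝔇 r K s)] {δw : ℝ} (hδw : 0 ≤ δw) (ϖw : ∀ r K (t : ℝ) s, 𝔖 r K s → ℝ)
    (dis : ∀ r K (t : ℝ) s, 𝔖 r K s → 𝔖 r K s → ℝ) (hϖw : ∀ r K t s, ∀ x y, ϖw r K t s x ≤ ϖw r K t s y + dis r K t s x y)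
    (pos : ∀ r K (t : ℝ) s, Λw r K s → 𝔖 r K s) (posz : ∀ r K (t : ℝ) s, Λz r K s → 𝔖 r K s)
    (pos' : ∀ r K (t : ℝ) s, ↥(Sw r K s) → 𝔖 r K s) (posx : ∀ r K (t : ℝ) s, ↥(Sw' r K s) → 𝔖 r K s)
    (posb : ∀ r K (t : ℝ) s, Λb r K s → 𝔖 r K s)
    (k𝒢 : ∀ r K (t : ℝ) s, GaugeField (P r K s) (jl r K s) SU2 → Λw r K s → Λz r K s → (ℭ r K s →L[ℂ] (𝔄w r K s)))
    (kι : ∀ r K (t : ℝ) s, GaugeField (P r K s) (jl r K s) SU2 → ↥(Sw r K s) → Λw r K s → (𝔄w r K s →L[ℂ] (𝔸 r K s)))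
    (kH : ∀ r K (t : ℝ) s, GaugeField (P r K s) (jl r K s) SU2 → Λw r K s → ↥(Sw' r K s) → (𝔸 r K s →L[ℂ] (𝔄w r K s)))
    (kH₁ : ∀ r K (t : ℝ) s, GaugeField (P r K s) (jl r K s) SU2 → Λw r K s → Λb r K s → (𝔇 r K s →L[ℂ] (𝔄w r K s)))
    {c𝒢 δ𝒢 M𝒢 cι δι Mι cH δH MH cH₁ δH₁ MH₁ : ℝ} (hc𝒢 : 0 ≤ c𝒢) (hM𝒢 : 0 ≤ M𝒢)
    (hk𝒢 : ∀ r K t s, ∀ V c b', ‖k𝒢 r K t s V c b'‖ ≤ c𝒢 * Real.exp (-(δ𝒢 * dis r K t s (pos r K t s c) (posz r K t s b'))))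
    (hM𝒢' : ∀ r K t s, ∀ x, ∑ b', Real.exp (-((δ𝒢 - δw) * dis r K t s x (posz r K t s b'))) ≤ M𝒢) (hcι : 0 ≤ cι) (hMι : 0 ≤ Mι)
    (hkι : ∀ r K t s, ∀ V c b', ‖kι r K t s V c b'‖ ≤ cι * Real.exp (-(δι * dis r K t s (pos' r K t s c) (pos r K t s b'))))
    (hMι' : ∀ r K t s, ∀ x, ∑ b', Real.exp (-((δι - δw) * dis r K t s x (pos r K t s b'))) ≤ Mι) (hcH : 0 ≤ cH) (hMH : 0 ≤ MH)
    (hkH : ∀ r K t s, ∀ V c b', ‖kH r K t s V c b'‖ ≤ cH * Real.exp (-(δH * dis r K t s (pos r K t s c) (posx r K t s b'))))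
    (hMH' : ∀ r K t s, ∀ x, ∑ b', Real.exp (-((δH - δw) * dis r K t s x (posx r K t s b'))) ≤ MH) (hcH₁ : 0 ≤ cH₁)
    (hMH₁ : 0 ≤ MH₁)
    (hkH₁ : ∀ r K t s, ∀ V c b', ‖kH₁ r K t s V c b'‖ ≤ cH₁ * Real.exp (-(δH₁ * dis r K t s (pos r K t s c) (posb r K t s b'))))
    (hMH₁' : ∀ r K t s, ∀ x, ∑ b', Real.exp (-((δH₁ - δw) * dis r K t s x (posb r K t s b'))) ≤ MH₁)
    (W𝒱w : ∀ r K (t : ℝ) s, GaugeField (P r K s) (jl r K s) SU2 → (Λw r K s → 𝔄w r K s) → (Λz r K s → ℭ r K s))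
    {B₀w C₄w a₃w ε₄w bw : ℝ} (h𝒢w : ∀ r K t s, ∀ V f, ‖kerOp (k𝒢 r K t s V) f‖ ≤ B₀w * ‖f‖)
    (hWw : ∀ r K t s, ∀ V, Prop4Hyp (W𝒱w r K t s V) C₄w a₃w) (hB₀w : 0 < B₀w) (hC₄w : 0 ≤ C₄w) (hε₄w : 0 ≤ ε₄w)
    (hdomw : 2 * (ε₄w + B₀w * bw) ≤ a₃w) (hselfw : B₀w * C₄w * (ε₄w + B₀w * bw) ^ 2 ≤ ε₄w)
    (hcontrw : 4 * B₀w * C₄w * (ε₄w + B₀w * bw) < 1) (hH₁w : ∀ r K t s, ∀ V B, ‖kerOp (kH₁ r K t s V) B‖ ≤ B₀w * ‖B‖)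
    (Φw : ∀ r K (t : ℝ) s, GaugeField (P r K s) (jl r K s) SU2 → (Fin (m₀ r K s) → ℂ) → (Λb r K s → 𝔇 r K s)) {rΦw : ℝ}
    (hΦdw : ∀ r K t s, ∀ V, DifferentiableOn ℂ (Φw r K t s V) (ball 0 rΦw)) (hΦ0w : ∀ r K t s, ∀ V, Φw r K t s V 0 = 0)
    (hΦbw : ∀ r K t s, ∀ V, ∀ z ∈ ball (0 : Fin (m₀ r K s) → ℂ) rΦw, ‖Φw r K t s V z‖ < bw) (h2Sw : 2 * S ≤ rΦw)
    (hιw : ∀ r K t s, ∀ V Y, ‖kerOp (kι r K t s V) Y‖ ≤ ‖Y‖) (hHw : ∀ r K t s, ∀ V X, ‖kerOp (kH r K t s V) X‖ ≤ B₀w * ‖X‖)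
    (hqw : ∀ r K s, 9 * C2cov (P r K s).d * B₀w * (ε₄w + B₀w * bw) < 1)
    (hRCw : ∀ r K s, 6 * (ε₄w + B₀w * bw) ≤ landauRad (P r K s).d (P r K s).L)
    (NW : ∀ r K (t : ℝ) s, Λz r K s → Λw r K s → Prop)
    (hlocW : ∀ r K t s, ∀ V, ∀ A A' : Λw r K s → 𝔄w r K s, ∀ c', (∀ b', NW r K t s c' b' → A b' = A' b') → W𝒱w r K t s V A c' =
      W𝒱w r K t s V A' c')
    {rW : ℝ} (hreachW : ∀ r K t s, ∀ c' b', NW r K t s c' b' → ϖw r K t s (posz r K t s c') - rW ≤ ϖw r K t s (pos r K t s b'))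
    {rC : ℝ}
    (hreachC : ∀ r K t s, ∀ (c' : ↥(Sw' r K s)) (b' : ↥(Sw r K s)), BondIn (loK (P r K s).L (k r K s) c'.1.1) (bondHiK (P r K
      s).L (k r K s) c'.1.1 c'.1.2) b'.1.1 b'.1.2 → ϖw r K t s (posx r K t s c') - rC ≤ ϖw r K t s (pos' r K t s b'))
    (hsupp : ∀ r K t s, ∀ V, ∀ z : Fin (m₀ r K s) → ℂ, ∀ i, 0 < ϖw r K t s (posb r K t s i) → Φw r K t s V z i = 0)
    (hqW : c𝒢 * M𝒢 * (2 * C₄w * a₃w * Real.exp (δw * rW)) < 1)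
    (hk : ∀ r K s, 2 * C2cov (P r K s).d * landauRad (P r K s).d (P r K s).L * Real.exp (δw * rC) * (cι * Mι) * (cH * MH) < 1)
    {𝔭 : Bool → ℕ → σ → Type*} (Pw : ∀ r K (t : ℝ) s, Finset (𝔭 r K s))
    (ℓw : ∀ r K (t : ℝ) s, 𝔭 r K s → List ((Λw r K s → 𝔄w r K s) →L[ℂ] Matrix n n ℂ))
    (suppw : ∀ r K (t : ℝ) s, 𝔭 r K s → Finset (Λw r K s)) (ϖPw : ∀ r K (t : ℝ) s, 𝔭 r K s → ℝ)
    (hblindw : ∀ r K t s, ∀ p ∈ Pw r K t s, ∀ ℓ ∈ ℓw r K t s p, ∀ A A' : Λw r K s → 𝔄w r K s, (∀ b' ∈ suppw r K t s p, A b' = A'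
      b') → ℓ A = ℓ A')
    (hdepthw : ∀ r K t s, ∀ p ∈ Pw r K t s, ∀ b' ∈ suppw r K t s p, ϖPw r K t s p ≤ ϖw r K t s (pos r K t s b'))
    (hϖPw : ∀ r K t s, ∀ p ∈ Pw r K t s, 0 ≤ ϖPw r K t s p) {κwb κcb : Bool → ℕ → ℝ} (hκwb : ∀ r K s, 0 ≤ κwb r (jl r K s))
    (hκcb : ∀ r K s, 0 ≤ κcb r (jl r K s)) (hℓwb : ∀ r K t s, ∀ p ∈ Pw r K t s, ∀ ℓ ∈ ℓw r K t s p, ‖ℓ‖ ≤ κwb r (jl r K s))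
    (hcurlw : ∀ r K t s, ∀ p ∈ Pw r K t s, ‖(ℓw r K t s p).sum‖ ≤ κcb r (jl r K s)) {mw : ℕ}
    (hlenw : ∀ r K t s, ∀ p ∈ Pw r K t s, (ℓw r K t s p).length ≤ mw)
    (𝓡𝒴w : ∀ r K (t : ℝ) s, AddSubgroup (Λw r K s → 𝔄w r K s))
    (h𝓡𝒴w : ∀ r K t s, IsClosed (𝓡𝒴w r K t s : Set (Λw r K s → 𝔄w r K s)))
    (𝓡𝒵w : ∀ r K (t : ℝ) s, AddSubgroup (Λz r K s → ℭ r K s)) (𝓡ℬw : ∀ r K (t : ℝ) s, AddSubgroup (Λb r K s → 𝔇 r K s))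
    (h𝒢rw : ∀ r K t s, ∀ V, ∀ f ∈ 𝓡𝒵w r K t s, kerOp (k𝒢 r K t s V) f ∈ 𝓡𝒴w r K t s)
    (hWrw : ∀ r K t s, ∀ V, ∀ Y ∈ 𝓡𝒴w r K t s, W𝒱w r K t s V Y ∈ 𝓡𝒵w r K t s)
    (hιrw : ∀ r K t s, ∀ V, ∀ Y ∈ 𝓡𝒴w r K t s, kerOp (kι r K t s V) Y ∈ skewPi ↥(Sw r K s))
    (hHrw : ∀ r K t s, ∀ V, ∀ X ∈ skewPi (𝔸 := 𝔸 r K s) ↥(Sw' r K s), kerOp (kH r K t s V) X ∈ 𝓡𝒴w r K t s)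
    (hH₁rw : ∀ r K t s, ∀ V, ∀ B ∈ 𝓡ℬw r K t s, kerOp (kH₁ r K t s V) B ∈ 𝓡𝒴w r K t s)
    (hΦrw : ∀ r K t s, ∀ V, ∀ y : Fin (m₀ r K s) → ℝ, ‖y‖ ≤ S → Φw r K t s V (cplx y) ∈ 𝓡ℬw r K t s)
    (hskew : ∀ r K t s, ∀ p ∈ Pw r K t s, ∀ ℓ ∈ ℓw r K t s p, ∀ Y ∈ 𝓡𝒴w r K t s, ℓ Y ∈ skewAdjoint (Matrix n n ℂ))
    (Bp : ∀ r K (t : ℝ) s, GaugeField (P r K s) (jl r K s) SU2 → 𝔭 r K s → Matrix n n ℂ) {d : ∀ r K (t : ℝ) s, 𝔭 r K s → ℝ}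
    {dbar : Bool → ℕ → ℝ} (hBu : ∀ r K t s, ∀ V, ∀ p ∈ Pw r K t s, Bp r K t s V p ∈ unitary (Matrix n n ℂ))
    (hBd : ∀ r K t s, ∀ V, ∀ p ∈ Pw r K t s, ‖Bp r K t s V p - 1‖ ≤ d r K t s p)
    (hd : ∀ r K t s, ∀ p ∈ Pw r K t s, d r K t s p ≤ dbar r (jl r K s)) (hdbar : ∀ r K s, 0 ≤ dbar r (jl r K s))
    {Kw : Bool → ℕ → ℝ} (hKw : ∀ r K t s, ∑ p ∈ Pw r K t s, Real.exp (-(δw * ϖPw r K t s p)) ≤ Kw r (jl r K s))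
    {Λe : Bool → ℕ → σ → Type*} [∀ r K s, Fintype (Λe r K s)] {𝔄 : Bool → ℕ → σ → Type*} [∀ r K s, NormedAddCommGroup (𝔄 r K s)]
    [∀ r K s, NormedSpace ℂ (𝔄 r K s)] [∀ r K s, CompleteSpace (𝔄 r K s)] {δ' : ℝ} {ϖ : ∀ r K (t : ℝ) s, Λe r K s → ℝ}
    (hδ' : 0 ≤ δ') (hϖ : ∀ r K t s, ∀ b', 0 ≤ ϖ r K t s b') {𝒵e ℬe : Bool → ℕ → σ → Type*}
    [∀ r K s, NormedAddCommGroup (𝒵e r K s)] [∀ r K s, NormedSpace ℂ (𝒵e r K s)] [∀ r K s, NormedAddCommGroup (ℬe r K s)]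
    [∀ r K s, NormedSpace ℂ (ℬe r K s)]
    (𝒢e : ∀ r K t s, GaugeField (P r K s) (jl r K s) SU2 → (𝒵e r K s →L[ℂ] WSup (pinW δ' (ϖ r K t s)) 1 (𝔄 r K s)))
    (W𝒱e : ∀ r K t s, GaugeField (P r K s) (jl r K s) SU2 → WSup (pinW δ' (ϖ r K t s)) 1 (𝔄 r K s) → 𝒵e r K s)
    {B₀e C₄e a₃e be ε₄e : ℝ} (h𝒢e : ∀ r K t s, ∀ V f, ‖𝒢e r K t s V f‖ ≤ B₀e * ‖f‖)
    (hWe : ∀ r K t s, ∀ V, Prop4Hyp (W𝒱e r K t s V) C₄e a₃e) (hB₀e : 0 < B₀e) (hC₄e : 0 ≤ C₄e) (hbe : 0 ≤ be) (hε₄e : 0 ≤ ε₄e)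
    (hdome : 2 * (ε₄e + B₀e * be) ≤ a₃e) (hselfe : B₀e * C₄e * (ε₄e + B₀e * be) ^ 2 ≤ ε₄e)
    (hcontre : 4 * B₀e * C₄e * (ε₄e + B₀e * be) < 1)
    (H₁e : ∀ r K t s, GaugeField (P r K s) (jl r K s) SU2 → (ℬe r K s →L[ℂ] WSup (pinW δ' (ϖ r K t s)) 1 (𝔄 r K s)))
    (hH₁e : ∀ r K t s, ∀ V B, ‖H₁e r K t s V B‖ ≤ B₀e * ‖B‖)
    (Φe : ∀ r K (t : ℝ) s, GaugeField (P r K s) (jl r K s) SU2 → (Fin (m₀ r K s) → ℂ) → ℬe r K s) {rΦe : ℝ}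
    (hΦde : ∀ r K t s, ∀ V, DifferentiableOn ℂ (Φe r K t s V) (ball 0 rΦe)) (hΦ0e : ∀ r K t s, ∀ V, Φe r K t s V 0 = 0)
    (hΦbe : ∀ r K t s, ∀ V, ∀ z ∈ ball (0 : Fin (m₀ r K s) → ℂ) rΦe, ‖Φe r K t s V z‖ < be) (hSre : S < rΦe)
    (ιe : ∀ r K t s, GaugeField (P r K s) (jl r K s) SU2 → (WSup (pinW δ' (ϖ r K t s)) 1 (𝔄 r K s) →L[ℂ] WSup (pinW δ' (ϖe₁ r K
      t s)) 1 (𝔸 r K s)))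
    (hιe : ∀ r K t s, ∀ V Y, ‖ιe r K t s V Y‖ ≤ ‖Y‖)
    (He : ∀ r K t s, GaugeField (P r K s) (jl r K s) SU2 → (WSup (pinW δ' (ϖe₂ r K t s)) 1 (𝔸 r K s) →L[ℂ] WSup (pinW δ' (ϖ r K
      t s)) 1 (𝔄 r K s)))
    (hHe : ∀ r K t s, ∀ V X, ‖He r K t s V X‖ ≤ B₀e * ‖X‖)
    (hqe : ∀ r K s, 9 * (C2cov (P r K s).d * Real.exp (2 * δ' * r₀e)) * B₀e * (ε₄e + B₀e * be) < 1)
    (hRCe : ∀ r K s, 3 * (ε₄e + B₀e * be) ≤ landauRad (P r K s).d (P r K s).L) {𝔱 : Bool → ℕ → σ → Type*}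
    (I : ∀ r K (t : ℝ) s, Finset (𝔱 r K s)) {Ef : ∀ r K (t : ℝ) s, 𝔱 r K s → (Λe r K s → 𝔄 r K s) → ℂ} {rE : ℝ}
    {ee : ∀ r K (t : ℝ) s, 𝔱 r K s → ℝ} (hrE : 0 < rE)
    (hEd : ∀ r K t s, ∀ i ∈ I r K t s, DifferentiableOn ℂ (Ef r K t s i) (ball 0 rE))
    (hEb : ∀ r K t s, ∀ i ∈ I r K t s, ∀ Z ∈ ball (0 : Λe r K s → 𝔄 r K s) rE, ‖Ef r K t s i Z‖ ≤ ee r K t s i)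
    (he0 : ∀ r K t s, ∀ i ∈ I r K t s, 0 ≤ ee r K t s i) (supp : ∀ r K (t : ℝ) s, 𝔱 r K s → Finset (Λe r K s))
    (hblind : ∀ r K t s, ∀ i ∈ I r K t s, ∀ A₁ A₂ : Λe r K s → 𝔄 r K s, (∀ b' ∈ supp r K t s i, A₁ b' = A₂ b') → Ef r K t s i A₁
      = Ef r K t s i A₂)
    (ϖP : ∀ r K (t : ℝ) s, 𝔱 r K s → ℝ)
    (hdepth : ∀ r K t s, ∀ i ∈ I r K t s, ∀ b' ∈ supp r K t s i, ϖP r K t s i ≤ ϖ r K t s b') {LK : ℝ} (hLK : 0 ≤ LK)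
    (hK : ∀ r K t s, ∑ i ∈ I r K t s, 2 * ee r K t s i / rE * Real.exp (-(δ' * ϖP r K t s i)) ≤ LK)
    (hcoupE : ∀ r K s, ((ε₄e + B₀e * be) + B₀e * (4 * (C2cov (P r K s).d * Real.exp (2 * δ' * r₀e)) * (ε₄e + B₀e * be) ^ 2)) ≤
      rE / 2)
    {BE₁ : ℝ}
    (hElb₁ : ∀ r K t s, ∀ V (y : Fin (m₀ r K s) → ℝ), ‖y‖ ≤ S → -BE₁ ≤ (∑ i ∈ I r K t s, Ef r K t s i (WSup.toPiL (𝔄 := 𝔄 r K s)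
      (pinW δ' (ϖ r K t s)) 1 (landauExp (fun Y : WSup (pinW δ' (ϖe₁ r K t s)) 1 (𝔸 r K s) => ((toPiL (pinW δ' (ϖe₂ r K t s))
      1).symm (landauCf (P r K s).L (Ubg r K t s V) (k r K s) (Se r K s) (Se' r K s) (toPiL (pinW δ' (ϖe₁ r K t s)) 1 Y)) : WSup
      (pinW δ' (ϖe₂ r K t s)) 1 (𝔸 r K s))) (ιe r K t s V) (He r K t s V) (4 * (C2cov (P r K s).d * Real.exp (2 * δ' * r₀e)) *
      (ε₄e + B₀e * be) ^ 2) (solAt (𝒢e r K t s V) 0 (W𝒱e r K t s V) ε₄e (0 : 𝒵e r K s) (H₁e r K t s V (Φe r K t s V (cplx y))) +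
      H₁e r K t s V (Φe r K t s V (cplx y)))))).re)
    {Ω : Bool → ℕ → σ → Type*} [∀ r K s, MeasurableSpace (Ω r K s)] (μ : ∀ r K (t : ℝ) s, Measure (Ω r K s))
    {g : ∀ r K (t : ℝ) s, Ω r K s → ℝ} (hg : ∀ r K t s, ∀ ω, 0 ≤ g r K t s ω)
    (Aex : ∀ r K (t : ℝ) s, GaugeField (P r K s) (jl r K s) SU2 → (Fin (m₀ r K s) → ℝ) → Ω r K s → ℝ) {Bd : ℝ} (hBd0 : 0 ≤ Bd)
    (hint : ∀ r K t s, ∀ V, ∀ x ∈ W r K t s V, ∀ c : ℝ, 1 / 2 ≤ c → c ≤ 1 → Integrable (fun ω => g r K t s ω * Real.exp (Aex r K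
      t s V (c • x) ω)) (μ r K t s))
    (hpos : ∀ r K t s, ∀ V, ∀ x ∈ W r K t s V, ∀ c : ℝ, 1 / 2 ≤ c → c ≤ 1 → 0 < ∫ ω, g r K t s ω * Real.exp (Aex r K t s V (c •
      x) ω) ∂(μ r K t s))
    (hA : ∀ r K t s, ∀ V, ∀ x ∈ W r K t s V, ∀ c : ℝ, 1 / 2 ≤ c → c ≤ 1 → ∀ ω, Aex r K t s V x ω ≤ Aex r K t s V (c • x) ω + (1
      - c) * Bd)
    {BE₂ : ℝ}
    (hElb₂ : ∀ r K t s, ∀ V (y : Fin (m₀ r K s) → ℝ), ‖y‖ ≤ S → -BE₂ ≤ (-Real.log (∫ ω, g r K t s ω * Real.exp (Aex r K t s V y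
      ω) ∂(μ r K t s))))
    (L : ∀ r K (t : ℝ) s, Set (𝒴 r K s →L[ℂ] Matrix n n ℂ)) (𝓡𝒵 : ∀ r K (t : ℝ) s, AddSubgroup (𝒵 r K s))
    (𝓡ℬ : ∀ r K (t : ℝ) s, AddSubgroup (ℬ r K s))
    (h𝒢r : ∀ r K t s, ∀ V, ∀ f ∈ 𝓡𝒵 r K t s, 𝒢 r K t s V f ∈ readOutReal (L r K t s))
    (hWr : ∀ r K t s, ∀ V, ∀ Y ∈ readOutReal (L r K t s), W𝒱 r K t s V Y ∈ 𝓡𝒵 r K t s)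
    (hιr : ∀ r K t s, ∀ V, ∀ Y ∈ readOutReal (L r K t s), ιs r K t s V Y ∈ skewPi ↥(Sf r K s))
    (hHr : ∀ r K t s, ∀ V, ∀ X ∈ skewPi (𝔸 := 𝔸 r K s) ↥(Sf' r K s), Hop r K t s V X ∈ readOutReal (L r K t s))
    (hH₁r : ∀ r K t s, ∀ V, ∀ B ∈ 𝓡ℬ r K t s, H₁ r K t s V B ∈ readOutReal (L r K t s))
    (hΦr : ∀ r K t s, ∀ V, ∀ y : Fin (m₀ r K s) → ℝ, ‖y‖ ≤ S → Φ r K t s V (cplx y) ∈ 𝓡ℬ r K t s)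
    (hRdict : ∀ r K t s, ∀ V, ∀ x ∈ cube (m₀ r K s) S, F r K t s (fixTo (combBonds (lo r K s) (hi r K s)) 1 (updateFinset V (Λ r
      K s) (expFibreChart (Λ r K s) 1 (e r K s) x))) = Jco r K t s V x * ENNReal.ofReal (Real.exp (-((∑ p ∈ Pw r K t s, β r (jl
      r K s) * (1 - (Matrix.trace (Bp r K t s V p * holOf (ℓw r K t s p) (fun y => landauExp (landauCfBox (P r K s).L (Ubg r K t
      s V) (k r K s) (Sw r K s) (Sw' r K s) (landauRad (P r K s).d (P r K s).L)) (kerOp (kι r K t s V)) (kerOp (kH r K t s V))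
      (4 * C2cov (P r K s).d * (ε₄w + B₀w * bw) ^ 2) (solAt (kerOp (k𝒢 r K t s V)) 0 (W𝒱w r K t s V) ε₄w (0 : Λz r K s → ℭ r K
      s) (kerOp (kH₁ r K t s V) (Φw r K t s V (cplx y))) + kerOp (kH₁ r K t s V) (Φw r K t s V (cplx y)))) x)).re / Fintype.card
      n)) + ((∑ i ∈ I r K t s, Ef r K t s i (WSup.toPiL (𝔄 := 𝔄 r K s) (pinW δ' (ϖ r K t s)) 1 (landauExp (fun Y : WSup (pinW δ'
      (ϖe₁ r K t s)) 1 (𝔸 r K s) => ((toPiL (pinW δ' (ϖe₂ r K t s)) 1).symm (landauCf (P r K s).L (Ubg r K t s V) (k r K s) (Se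
      r K s) (Se' r K s) (toPiL (pinW δ' (ϖe₁ r K t s)) 1 Y)) : WSup (pinW δ' (ϖe₂ r K t s)) 1 (𝔸 r K s))) (ιe r K t s V) (He r
      K t s V) (4 * (C2cov (P r K s).d * Real.exp (2 * δ' * r₀e)) * (ε₄e + B₀e * be) ^ 2) (solAt (𝒢e r K t s V) 0 (W𝒱e r K t s
      V) ε₄e (0 : 𝒵e r K s) (H₁e r K t s V (Φe r K t s V (cplx x))) + H₁e r K t s V (Φe r K t s V (cplx x)))))).re + (-Real.log
      (∫ ω, g r K t s ω * Real.exp (Aex r K t s V x ω) ∂(μ r K t s))))))))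
    (hudict : ∀ r K t s, ∀ V, ∀ x ∈ cube (m₀ r K s) S, u r K t s (fixTo (combBonds (lo r K s) (hi r K s)) 1 (updateFinset V (Λ r
      K s) (expFibreChart (Λ r K s) 1 (e r K s) x))) = classifier (hPu r K t s) (fun p => holOf (ℓs r K t s p) (fun y =>
      landauExp ((ball (0 : ↥(Sf r K s) → 𝔸 r K s) (landauRad (P r K s).d (P r K s).L)).indicator (landauCf (P r K s).L (1 :
      B7Prop1Explicit.Site (P r K s).d → Fin (P r K s).d → (𝔸 r K s)ˣ) (k r K s) (Sf r K s) (Sf' r K s))) (ιs r K t s V) (Hop r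
      K t s V) (4 * C2cov (P r K s).d * (ε₄ + B₀ * (2 * dL * C₁ * ε₁)) ^ 2) (solAt (𝒢 r K t s V) 0 (W𝒱 r K t s V) ε₄ (0 : 𝒵 r K
      s) (H₁ r K t s V (Φ r K t s V (cplx y))) + H₁ r K t s V (Φ r K t s V (cplx y))))) x)
    (hJW : ∀ r K t s, ∀ V x, Jco r K t s V x ≠ 0 → x ∈ W r K t s V)
    (hJ : ∀ r K t s, ∀ V x, ∀ a : ℝ, 0 ≤ a → Jco r K t s V x ≤ Jco r K t s V (Real.exp (-a) • x))
    (hJ1 : ∀ r K t s, ∀ V x, Jco r K t s V x ≤ 1) (hWS : ∀ r K t s, ∀ V, W r K t s V ⊆ closedBall (0 : Fin (m₀ r K s) → ℝ) S)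
    (hδ0 : 0 ≤ δ) (hδ1 : δ < 1)
    {c₁ c₂ zs : ℝ}
    (hs₁ : ∀ r K s, κc r (jl r K s) * ((ε₄ + B₀ * (2 * dL * C₁ * ε₁)) + B₀ * (4 * C2cov (P r K s).d * (ε₄ + B₀ * (2 * dL * C₁ *
      ε₁)) ^ 2)) ≤ c₁ * η r (jl r K s) ^ 2 * zs)
    (ha : ∀ r K s, κr r (jl r K s) * ((ε₄ + B₀ * (2 * dL * C₁ * ε₁)) + B₀ * (4 * C2cov (P r K s).d * (ε₄ + B₀ * (2 * dL * C₁ *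
      ε₁)) ^ 2)) ≤ c₂ * η r (jl r K s) * zs)
    (hma : ∀ r K s, m * (κr r (jl r K s) * ((ε₄ + B₀ * (2 * dL * C₁ * ε₁)) + B₀ * (4 * C2cov (P r K s).d * (ε₄ + B₀ * (2 * dL *
      C₁ * ε₁)) ^ 2))) ≤ 1)
    (hsm : ∀ r K s, 36 * (c₁ * zs + m ^ 2 * c₂ ^ 2 * zs ^ 2) / (rΦ / S - 1) ^ 2 ≤ δ * ε r (K - lvl r K s))
    {a : ℝ} (ha0 : 0 ≤ a) (hrad : ∀ r K s, (((P r K s).d - 1 : ℕ) : ℝ) * nb r K s * a ≤ 2 * Real.sin (S / 2))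
    {Pcore Pcollar : ∀ r K (t : ℝ) s, Set (Plaq (P r K s) (jl r K s))}
    (hcover : ∀ r K t s, boxPlaqs (lo r K s) (hi r K s) ⊆ Pcore r K t s ∪ (Pcollar r K t s))
    (hcore : ∀ r K t s, ∀ (V : GaugeField (P r K s) (jl r K s) SU2) (y : ↥(Λ r K s) → SU2), u r K t s (fixTo (combBonds (lo r K
      s) (hi r K s)) 1 (updateFinset V (Λ r K s) y)) < ε r (K - lvl r K s) * η r (jl r K s) ^ 2 → PlaqSmallOn (Pcore r K t s) a
      (fixTo (combBonds (lo r K s) (hi r K s)) 1 (updateFinset V (Λ r K s) y)))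
    (hcollar : ∀ r K t s, ∀ (V : GaugeField (P r K s) (jl r K s) SU2) (y : ↥(Λ r K s) → SU2), F r K t s (fixTo (combBonds (lo r
      K s) (hi r K s)) 1 (updateFinset V (Λ r K s) y)) ≠ 0 → PlaqSmallOn (Pcollar r K t s) a (fixTo (combBonds (lo r K s) (hi r
      K s)) 1 (updateFinset V (Λ r K s) y)))
    (hρ : ∀ r j, ρ r j ≤ (1 - δ) / 2) (hβ : ∀ r j, 0 ≤ β r j)
    -- the slot → level majorant: S99 f3b's slot constant (written out ONCE) under the displayed level profile `D r`
    (hDslot : ∀ r K t, |t| ≤ l₀ → ∀ s ∈ Sl r K, 2 * ((m₀ r K s : ℝ) + (3 * (|β r (jl r K s)| * ((dbar r (jl r K s) + 2 * (κcb r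
      (jl r K s) * (cH₁ * MH₁ * bw / ((1 - c𝒢 * M𝒢 * (2 * C₄w * a₃w * Real.exp (δw * rW))) * (1 - 2 * C2cov (P r K s).d *
      landauRad (P r K s).d (P r K s).L * Real.exp (δw * rC) * (cι * Mι) * (cH * MH)))) + expTail₂ (mw * (κwb r (jl r K s) *
      (cH₁ * MH₁ * bw / ((1 - c𝒢 * M𝒢 * (2 * C₄w * a₃w * Real.exp (δw * rW))) * (1 - 2 * C2cov (P r K s).d * landauRad (P r K
      s).d (P r K s).L * Real.exp (δw * rC) * (cι * Mι) * (cH * MH))))))) / (rΦw / S)) * (2 * (κcb r (jl r K s) * (cH₁ * MH₁ *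
      bw / ((1 - c𝒢 * M𝒢 * (2 * C₄w * a₃w * Real.exp (δw * rW))) * (1 - 2 * C2cov (P r K s).d * landauRad (P r K s).d (P r K
      s).L * Real.exp (δw * rC) * (cι * Mι) * (cH * MH)))) + expTail₂ (mw * (κwb r (jl r K s) * (cH₁ * MH₁ * bw / ((1 - c𝒢 * M𝒢
      * (2 * C₄w * a₃w * Real.exp (δw * rW))) * (1 - 2 * C2cov (P r K s).d * landauRad (P r K s).d (P r K s).L * Real.exp (δw *
      rC) * (cι * Mι) * (cH * MH))))))) / (rΦw / S))) * Kw r (jl r K s)) + (3 * (LK * (2 * ((ε₄e + B₀e * be) + B₀e * (4 * (C2cov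
      (P r K s).d * Real.exp (2 * δ' * r₀e)) * (ε₄e + B₀e * be) ^ 2)))) / (rΦe / S - 1) + Bd))) / (1 - δ) ≤ D r (lvl r K s))
    -- END-I's own rows ((R)+[dict] with the NORMALISED variables, finiteness, windows, `D ≤ D̄`, rates) — S27 VERBATIM
    {ι : Type*} {T : ℕ → Finset ι} {A B shA shB : ℕ → ℝ → ι → ℝ}
    {pieceA pieceB : ℕ → ℝ → σ → ι → ℝ} {MA MB : ℕ → ℝ → σ → ℝ} {N₁ : ℕ} {νbar Dbar crate ϑ : ℝ}
    (hFfin : ∀ r K t s, ∫⁻ U, F r K t s U ∂(fieldMeasure (P r K s) (jl r K s) SU2) ≠ ∞)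
    (sh_nonnegA : ∀ K t, |t| ≤ l₀ → ∀ τ ∈ T K, 0 ≤ shA K t τ)
    (sh_leA : ∀ K t, |t| ≤ l₀ → ∀ τ ∈ T K, shA K t τ ≤ A K t τ)
    (coverA : ∀ K t, |t| ≤ l₀ → ∀ τ ∈ T K, shA K t τ ≤ ∑ s ∈ Sl true K, pieceA K t s τ)
    (hMA : ∀ K t, |t| ≤ l₀ → ∀ s ∈ Sl true K, 0 ≤ MA K t s)
    (piece_leA : ∀ K t, |t| ≤ l₀ → ∀ s ∈ Sl true K, ∑ τ ∈ T K, pieceA K t s τ ≤ MA K t s *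
      (((fieldMeasure (P true K s) (jl true K s) SU2).withDensity (F true K t s))
        {x | ε true (K - lvl true K s) * (1 - ρ true (lvl true K s)) ≤ u true K t s x / η true (jl true K s) ^ 2 ∧
          u true K t s x / η true (jl true K s) ^ 2 < ε true (K - lvl true K s)}).toReal)
    (total_geA : ∀ K t, |t| ≤ l₀ → ∀ s ∈ Sl true K,
      MA K t s * (((fieldMeasure (P true K s) (jl true K s) SU2).withDensity (F true K t s)) Set.univ).toReal ≤
        ∑ τ ∈ T K, A K t τ)
    (sh_nonnegB : ∀ K t, |t| ≤ l₀ → ∀ τ ∈ T K, 0 ≤ shB K t τ)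
    (sh_leB : ∀ K t, |t| ≤ l₀ → ∀ τ ∈ T K, shB K t τ ≤ B K t τ)
    (coverB : ∀ K t, |t| ≤ l₀ → ∀ τ ∈ T K, shB K t τ ≤ ∑ s ∈ Sl false K, pieceB K t s τ)
    (hMB : ∀ K t, |t| ≤ l₀ → ∀ s ∈ Sl false K, 0 ≤ MB K t s)
    (piece_leB : ∀ K t, |t| ≤ l₀ → ∀ s ∈ Sl false K, ∑ τ ∈ T K, pieceB K t s τ ≤ MB K t s *
      (((fieldMeasure (P false K s) (jl false K s) SU2).withDensity (F false K t s))
        {x | ε false (K - lvl false K s) * (1 - ρ false (lvl false K s)) ≤ u false K t s x / η false (jl false K s) ^ 2 ∧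
          u false K t s x / η false (jl false K s) ^ 2 < ε false (K - lvl false K s)}).toReal)
    (total_geB : ∀ K t, |t| ≤ l₀ → ∀ s ∈ Sl false K,
      MB K t s * (((fieldMeasure (P false K s) (jl false K s) SU2).withDensity (F false K t s)) Set.univ).toReal ≤
        ∑ τ ∈ T K, B K t τ)
    (hw : ∀ r, LiveWindow (Sl r) (lvl r) N₁ νbar) (hϑ0 : 0 < ϑ) (hϑ1 : ϑ < 1)
    (hDbar : ∀ r j, D r j ≤ Dbar) (hrate : ∀ r j, ρ r j ≤ crate * ϑ ^ j) :
    ShellWeightBound l₀ T A B shA shB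
      (fun K => ∑ s ∈ Sl true K, D true (lvl true K s) * ρ true (lvl true K s) +
        ∑ s ∈ Sl false K, D false (lvl false K s) * ρ false (lvl false K s)) := by
  -- file 1″: END-II of record (R11 discharged, S99 f3b) ∘ γ8 unit change, over the indexed families (both runs, every slot)
  have hlive := hac_live_of_assembled_decay_levels_cfB7 P jl lvl hη hε hρ0 hn hN Λ hΛbox hΛcomb e hS hSπ hF hFi hu hui hPu W Jco 𝒢 W𝒱 h𝒢 hW
    hB₀ hC₄ hε₄ hdL hC₁ hε₁ hB₃ h1 h2 h3 H₁ hH₁ Φ hΦd hΦ0 hΦ hSr k Sf Sf' Sw Sw' Se Se' Ubg hUbg hα hα3 hα4 hα6 h52locw h52loce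
    ϖe₁ ϖe₂ hϖe₁ hϖe₂ hreache ιs hι Hop hH h18 hcoup h3R ℓs hκ hℓ hlen hκc hcurl hδw ϖw dis hϖw pos posz pos' posx posb k𝒢 kι kH
    kH₁ hc𝒢 hM𝒢 hk𝒢 hM𝒢' hcι hMι hkι hMι' hcH hMH hkH hMH' hcH₁ hMH₁ hkH₁ hMH₁' W𝒱w h𝒢w hWw hB₀w hC₄w hε₄w hdomw hselfw hcontrw
    hH₁w Φw hΦdw hΦ0w hΦbw h2Sw hιw hHw hqw hRCw NW hlocW hreachW hreachC hsupp hqW hk Pw ℓw suppw ϖPw hblindw hdepthw hϖPw hκwb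
    hκcb hℓwb hcurlw hlenw 𝓡𝒴w h𝓡𝒴w 𝓡𝒵w 𝓡ℬw h𝒢rw hWrw hιrw hHrw hH₁rw hΦrw hskew Bp hBu hBd hd hdbar hKw hδ' hϖ 𝒢e W𝒱e h𝒢e hWe
    hB₀e hC₄e hbe hε₄e hdome hselfe hcontre H₁e hH₁e Φe hΦde hΦ0e hΦbe hSre ιe hιe He hHe hqe hRCe I hrE hEd hEb he0 supp hblind
    ϖP hdepth hLK hK hcoupE hElb₁ μ hg Aex hBd0 hint hpos hA hElb₂ L 𝓡𝒵 𝓡ℬ h𝒢r hWr hιr hHr hH₁r hΦr hRdict hudict hJW hJ hJ1 hWS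
    hδ0 hδ1 hs₁ ha hma hsm ha0 hrad hcover hcore hcollar hρ hβ
  -- END-I (S27 §2: slot towers, age thresholds) with `hacA`∕`hacB` DISCHARGED by `hlive true` ∕ `hlive false`
  exact shellWeightBound_of_towerData_sync (G := SU2) (PA := P true) (jA := jl true) (PB := P false) (jB := jl false)
    (θA := fun K s => ε true (K - lvl true K s)) (θB := fun K s => ε false (K - lvl false K s))
    (uA := fun K t s U => u true K t s U / η true (jl true K s) ^ 2)
    (uB := fun K t s U => u false K t s U / η false (jl false K s) ^ 2)
    (hFfin true) sh_nonnegA sh_leA coverA hMA piece_leA total_geA (hD0 true) (hρ0 true) (hDslot true)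
    (fun K t _ s _ => hlive true K t s)
    (hFfin false) sh_nonnegB sh_leB coverB hMB piece_leB total_geB (hD0 false) (hρ0 false) (hDslot false)
    (fun K t _ s _ => hlive false K t s)
    (hw true) (hw false) hϑ0 hϑ1 (hDbar true) (hDbar false) (hrate true) (hrate false)

/-- **(x2) NON-DEGENERACY ACROSS LEVELS** (R-ne7cp1-g34-1's ∕ R-ne7cp1-g35-4 (c)'s acceptance test (x2″)): with the designed profile `η r j := (2^j)⁻¹` — so
`η r 0 = 1 ≠ 1∕2 = η r 1`, TWO slots of DIFFERENT fine scale — and the LEVEL-INDEXED read-out constants `κr r j := 1·η r j`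
(NONZERO at every level), `κc r j := 1·(η r j)²`, the three (SM) rows of `shellWeightBound_live_oneCall_levels_cfB7` (`hs₁`, `ha`,
`hma` with `Z = c₁ = c₂ = zs = 1`, `m = 1`) hold at EVERY `(r, j)` — the owner's `ShellMeasureLiveEndLevelBlind.levelIndexed_rows`
BY NAME; the shared typing of S92 forced `κr = κc = 0` here (F-ne7cL05g9-1). [folklore] -/
example : ((fun (_ : Bool) (j : ℕ) => ((2 : ℝ) ^ j)⁻¹) true 0 ≠ (fun (_ : Bool) (j : ℕ) => ((2 : ℝ) ^ j)⁻¹) true 1) ∧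
    (∀ r j, (1 * (fun (_ : Bool) (j : ℕ) => ((2 : ℝ) ^ j)⁻¹) r j) ≠ 0) ∧
    ∀ r j, (1 * (fun (_ : Bool) (j : ℕ) => ((2 : ℝ) ^ j)⁻¹) r j ^ 2) * 1 ≤ 1 * (fun (_ : Bool) (j : ℕ) => ((2 : ℝ) ^ j)⁻¹) r j ^ 2 * 1 ∧
      (1 * (fun (_ : Bool) (j : ℕ) => ((2 : ℝ) ^ j)⁻¹) r j) * 1 ≤ 1 * (fun (_ : Bool) (j : ℕ) => ((2 : ℝ) ^ j)⁻¹) r j * 1 ∧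
      ((1 : ℕ) : ℝ) * ((1 * (fun (_ : Bool) (j : ℕ) => ((2 : ℝ) ^ j)⁻¹) r j) * 1) ≤ 1 := by
  refine ⟨by norm_num, fun r j => by positivity, ?_⟩
  exact ShellMeasureLiveEndLevelBlind.levelIndexed_rows (κbr := 1) (κbc := 1) (X := 1) (c₁ := 1) (c₂ := 1) (zs := 1) (m := 1)
    (η := fun (_ : Bool) (j : ℕ) => ((2 : ℝ) ^ j)⁻¹) (fun _ _ => by positivity)
    (fun _ j => by simpa using inv_le_one_of_one_le₀ (one_le_pow₀ (by norm_num : (1 : ℝ) ≤ 2))) zero_le_one zero_le_one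
    le_rfl le_rfl (by norm_num)

end Summit.QuantumFields.BalabanUV.T4Continuum.ShellMeasureLiveEndOneCallLevelsCf

end
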